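/-
Copyright: statement-level skeleton of a published paper (lit-balaban cell, Phase-2 proof seat p25, gen 15). No proof
claims beyond what the kernel checks below.
-/
import Literature.MathematicalPhysics.QuantumFieldTheory.BalabanImbrieJaffe1984to88.BIJ88VertexComponentsFieldLaw312

/-!
# `BalabanImbrieJaffe1984to88.BIJ88VertexChiCubes312` — T. Bałaban, J. Imbrie, A. Jaffe, *Effective action and cluster
properties of the abelian Higgs model*, Commun. Math. Phys. **114** (1988) 257–315 [BalabanImbrieJaffe1988], §5.14
p. 311–312 [PDF 55–56] *"A connected component of X is called complete if a contraction to χ′_{Λ^{(k)}} occurs … The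
components containing contractions to χ′_{Λ^{(k)}} … are called remainder components … By performing sufficiently many
integrations by parts, we have arranged for enough small factors to beat these large factors in the remainder terms"*
with (5.14.1) p. 308 (the cutoff `χ_{Λ^{(k)}}` a PRODUCT of single-cube cutoffs) — **THE `χ′` SMALL FACTOR, CUBE BY
CUBE**: for a cutoff `χ = Π_b χ_b` (one factor per cube `b`), the `χ′`-factor `(Π_D∂)χ` of a term of p25 gen 15's
component expansion (`BIJ88VertexComponentsExpansion311.gint`) is expanded by the multi-Leibniz rule over the
LABELINGS of the directions `D` by cubes (`dlist_prod`: every contraction to `χ′` hits one cube's cutoff), and each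
labelled summand vanishes off the INTERSECTION of the shells of all the cubes it hits (`ldl_eq_zero_off_shells`), so
its Cauchy–Schwarz bound carries `√μ(⋂_{b hit} Sh_b)` (`abs_ldl_integral_le_shells`, `abs_gint_prod_le_shells`) — where
the sibling `BIJ88VertexComponentsFieldLaw312.abs_gint_le_shell` had ONE global shell factor however many `χ′` a term
carries (its honest-scope item (b)/(c)).

statement-level skeleton of published theorems with citation tags; proofs where landed; nothing here is a claim
about the Yang–Mills mass gap

PDF held: `paper:balaban1988-cmp114-bij-abelian-higgs-effective-action` (journal page = PDF page + 256); p. 311–312 =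
PDF 55–56.

CITATION HEADER (lean-in-tree rule).  lit-balaban cell (HOME `run/shared/lean/pub/lit-balaban/`), Phase 2, seat p25
gen 15; row **C2.Claim@312** of `HOME/lit-balaban-r16/ROWS-C2-part2.md` (owner r16, referee ref-5; head untouched —
the localization half of flip-path item (γ) "each remainder component carries a small factor": the factor of a
`χ′`-term is now attributed to the cubes its derivatives hit).  USED BY NAME, nothing restated:
`BIJ88VertexComponentsExpansion311.gint`, `BIJ88VertexComponentsFieldLaw312.dlist_eq_zero_off_shell`,
`BIJ88VertexChiShell312.abs_integral_mul_le_shell`, `BIJ88VertexIbp311.{lmono, vexp, integrable_lmono}`, p25 gen 14's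
`BIJ88WickDerivatives305.{dlist, dlist_zero, contDiff_fderiv_apply_const}` and `BIJ88IbpLeibniz312.{dlist_contDiff,
dlist_add}`, Mathlib's `HasFDerivAt.finsetProd`.

## What is proved (0 `sorry`, standard axioms, no new `Prop` facts; definitions with bodies: `labelings`, `dirsAt`,
`ldl`, `hit`)

* §1 `labelings D` (all maps directions → cubes, as labelled lists), `dirsAt`, `ldl χ E = Π_b (Π_{dirsAt b E}∂)χ_b`,
  `hit E`; `ldl_nil`, **`ldl_cons`** (`ldl χ ((u,b₀)::E) = ldl χ[b₀ ↦ ∂_uχ_{b₀}] E`), `mem_hit_cons`;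
* §2 `contDiff_update`, **`fderiv_apply_prod`** (product rule in `update` form), `dlist_sum` (linearity over finite
  sums), **`dlist_prod`** (MULTI-LEIBNIZ: `(Π_D∂)(Π_bχ_b) = Σ_{E ∈ labelings D} ldl χ E`);
* §3 `continuous_ldl`, `tsupport_dlist_subset`, `tsupport_ldl_subset`, `hasCompactSupport_ldl` (from
  `⋂_b tsupport χ_b` compact), `ldl_vexp_bounded`, **`ldl_eq_zero_off_shells`**;
* §4 `integral_list_sum`, **`gint_prod_eq_sum`**, **`abs_ldl_integral_le_shells`**
  (`|∫Π_PΦ·ldl_E·e^{−V}dμ| ≤ √(∫Π_{P++P}Φdμ)·K_E·√μ(⋂_{b∈hit E}Sh_b)`), **`abs_gint_prod_le_shells`**;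
* §5 `hit_nonempty_of_mem` (`D ≠ []` ⇒ every labelling hits a cube), `length_labelings` (`|β|^{|D|}` labelings).
HONEST SCOPE.  (a) The small factor is `√μ(⋂_{b hit} Sh_b)` for the UNNORMALIZED Gaussian measure `dμ_{C,ℱ}`; that this is
`≈ Π_b (small)` needs approximate independence of distant cubes under `dμ_{C,ℱ}` (p36's shell tails, covariance decay)
— NOT done; (b) `K_E` (sup of the labelled summand times `e^{−V}`) and the `|β|^{|D|}` labelings are not estimated
(print controls them by locality of `C_loc`); (c) as in the siblings: contraction-graph components, one covariance, no
resummation.  NOT summit progress; NOT continuum; NOT Clay.  Imports `BIJ88VertexComponentsFieldLaw312` only; modifies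
nothing.
-/

noncomputable section

namespace Literature.MathematicalPhysics.QuantumFieldTheory.BalabanImbrieJaffe1984to88.BIJ88VertexChiCubes312

open MeasureTheory Matrix Finset
open scoped BigOperators ContDiff
open Literature.MathematicalPhysics.QuantumFieldTheory.Balaban1983to89
open B2Eq228Conditioning (weight source)
open BIJ88VertexIbp311 (lmono vexp lmono_append continuous_lmono continuous_vexp integrable_lmono)
open BIJ88WickDerivatives305 (dlist dlist_nil dlist_cons contDiff_fderiv_apply_const dlist_zero)
open BIJ88IbpLeibniz312 (dlist_contDiff dlist_add)
open BIJ88VertexChiShell312 (abs_integral_mul_le_shell)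
open BIJ88VertexComponentsExpansion311 (gint)
open BIJ88VertexComponentsFieldLaw312 (dlist_eq_zero_off_shell)

variable {S : Type} [Fintype S] {ι : Type} [Fintype ι] {β : Type} [Fintype β] [DecidableEq β]

/-! ## §1  Labelled lists of `χ′`-directions: which cube's cutoff each derivative hits -/

/-- **All labelings of a list of `χ′`-directions by cubes** (which factor `χ_b` of `χ = Π_b χ_b` each derivative hits, in
every possible way). [cite: BalabanImbrieJaffe1988, §5.14 p.311–312] -/
def labelings : List (S → ℝ) → List (List ((S → ℝ) × β))
  | [] => [[]]
  | u :: L => (univ : Finset β).toList.flatMap fun b => (labelings L).map (List.cons (u, b))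

/-- The directions of a labelled list hitting cube `b`, in order. [cite: BalabanImbrieJaffe1988, §5.14 p.311–312] -/
def dirsAt (b : β) (E : List ((S → ℝ) × β)) : List (S → ℝ) := (E.filter fun p => decide (p.2 = b)).map Prod.fst

/-- **The labelled summand** `Π_b (Π_{directions hitting b}∂)χ_b`. [cite: BalabanImbrieJaffe1988, §5.14 p.311–312] -/
def ldl (χb : β → (S → ℝ) → ℝ) (E : List ((S → ℝ) × β)) : (S → ℝ) → ℝ := fun φ => ∏ b, dlist (dirsAt b E) (χb b) φ

/-- The cubes hit by a labelled list. [cite: BalabanImbrieJaffe1988, §5.14 p.311–312] -/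
def hit (E : List ((S → ℝ) × β)) : Finset β := univ.filter fun b => dirsAt b E ≠ []

omit [Fintype S] [Fintype β] in
/-- `dirsAt b [] = []`. [cite: BalabanImbrieJaffe1988, §5.14 p.311] -/
@[simp] theorem dirsAt_nil (b : β) : dirsAt b ([] : List ((S → ℝ) × β)) = [] := rfl

omit [Fintype S] [Fintype β] in
/-- The head direction joins the list of its own cube. [cite: BalabanImbrieJaffe1988, §5.14 p.311] -/
theorem dirsAt_cons_self (b : β) (u : S → ℝ) (E : List ((S → ℝ) × β)) : dirsAt b ((u, b) :: E) = u :: dirsAt b E := by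
  simp [dirsAt]

omit [Fintype S] [Fintype β] in
/-- … and no other. [cite: BalabanImbrieJaffe1988, §5.14 p.311] -/
theorem dirsAt_cons_ne {b b₀ : β} (h : b ≠ b₀) (u : S → ℝ) (E : List ((S → ℝ) × β)) :
    dirsAt b ((u, b₀) :: E) = dirsAt b E := by
  simp [dirsAt, h.symm]

omit [Fintype S] in
/-- `ldl χb [] = Π_b χ_b`. [cite: BalabanImbrieJaffe1988, §5.14 p.311] -/
theorem ldl_nil (χb : β → (S → ℝ) → ℝ) : ldl χb [] = fun φ => ∏ b, χb b φ := by
  funext φ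
  simp [ldl]

omit [Fintype S] in
/-- **The head direction differentiates its cube's factor**: `ldl χ ((u,b₀) :: E) = ldl χ[b₀ ↦ ∂_uχ_{b₀}] E`.
[cite: BalabanImbrieJaffe1988, §5.14 p.311] -/
theorem ldl_cons (χb : β → (S → ℝ) → ℝ) (u : S → ℝ) (b₀ : β) (E : List ((S → ℝ) × β)) :
    ldl χb ((u, b₀) :: E) = ldl (Function.update χb b₀ fun φ => fderiv ℝ (χb b₀) φ u) E := by
  funext φ
  unfold ldl
  refine prod_congr rfl fun b _ => ?_
  by_cases hb : b = b₀
  · subst hb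
    rw [dirsAt_cons_self, dlist_cons, Function.update_self]
  · rw [dirsAt_cons_ne hb, Function.update_of_ne hb]

omit [Fintype S] [Fintype β] in
/-- The cubes hit by `(u,b₀) :: E` are `b₀` and those hit by `E`. [cite: BalabanImbrieJaffe1988, §5.14 p.311] -/
theorem mem_hit_cons {b b₀ : β} {u : S → ℝ} {E : List ((S → ℝ) × β)} [Fintype β] :
    b ∈ hit ((u, b₀) :: E) ↔ b = b₀ ∨ b ∈ hit E := by
  by_cases hb : b = b₀
  · subst hb; simp [hit, dirsAt_cons_self]
  · simp [hit, dirsAt_cons_ne hb, hb]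

/-! ## §2  The product rule for `χ = Π_b χ_b` and the multi-Leibniz expansion of `(Π_D∂)χ` -/

omit [Fintype β] in
/-- The factors stay smooth after one of them is differentiated. [folklore] [cite: BalabanImbrieJaffe1988, §5.14 p.311] -/
theorem contDiff_update {χb : β → (S → ℝ) → ℝ} (hχ : ∀ b, ContDiff ℝ ∞ (χb b)) (b₀ : β) (u : S → ℝ) (b : β) :
    ContDiff ℝ ∞ (Function.update χb b₀ (fun φ => fderiv ℝ (χb b₀) φ u) b) := by
  rcases eq_or_ne b b₀ with rfl | hb
  · rw [Function.update_self]; exact contDiff_fderiv_apply_const (hχ b) u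
  · rw [Function.update_of_ne hb]; exact hχ b

/-- **Product rule** in the `update` form: `∂_u Π_b χ_b = Σ_{b₀} Π_b χ[b₀ ↦ ∂_uχ_{b₀}]_b`.
[folklore] [cite: BalabanImbrieJaffe1988, §5.14 p.311] -/
theorem fderiv_apply_prod {χb : β → (S → ℝ) → ℝ} (hχ : ∀ b, ContDiff ℝ ∞ (χb b)) (u φ : S → ℝ) :
    fderiv ℝ (fun ψ => ∏ b, χb b ψ) φ u = ∑ b₀, ∏ b, Function.update χb b₀ (fun ψ => fderiv ℝ (χb b₀) ψ u) b φ := by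
  have hd : ∀ b ∈ (univ : Finset β), HasFDerivAt (χb b) (fderiv ℝ (χb b) φ) φ := fun b _ =>
    ((hχ b).differentiable (by simp) φ).hasFDerivAt
  rw [(HasFDerivAt.finsetProd hd).fderiv]
  simp only [FunLike.coe_sum, Finset.sum_apply, FunLike.coe_smul, Pi.smul_apply, smul_eq_mul]
  refine sum_congr rfl fun b₀ _ => ?_
  rw [← mul_prod_erase univ _ (mem_univ b₀), Function.update_self, mul_comm]
  congr 1
  exact prod_congr rfl fun b hb => by rw [Function.update_of_ne (ne_of_mem_erase hb)]

/-- `dlist` over a finite sum of smooth functions. [folklore] [cite: BalabanImbrieJaffe1988, §5.14 p.311] -/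
theorem dlist_sum (L : List (S → ℝ)) {γ : Type} (s : Finset γ) {G : γ → (S → ℝ) → ℝ}
    (hG : ∀ g ∈ s, ContDiff ℝ ∞ (G g)) :
    dlist L (fun φ => ∑ g ∈ s, G g φ) = fun φ => ∑ g ∈ s, dlist L (G g) φ := by
  classical
  induction s using Finset.induction_on with
  | empty =>
    simp only [sum_empty]
    exact dlist_zero L
  | insert a s ha ih =>
    have hs : ∀ g ∈ s, ContDiff ℝ ∞ (G g) := fun g hg => hG g (mem_insert_of_mem hg)
    have e : (fun φ => ∑ g ∈ insert a s, G g φ) = G a + fun φ => ∑ g ∈ s, G g φ := by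
      funext φ; simp [sum_insert ha]
    rw [e, dlist_add L (hG a (mem_insert_self a s)) (ContDiff.sum fun g hg => hs g hg), ih hs]
    funext φ
    simp [sum_insert ha]

omit [Fintype S] [Fintype ι] [Fintype β] [DecidableEq β] in
/-- Sums over a `flatMap` are iterated sums. [folklore] -/
private theorem sum_map_flatMap {α γ : Type} (l : List α) (g : α → List γ) (h : γ → ℝ) :
    ((l.flatMap g).map h).sum = (l.map fun a => ((g a).map h).sum).sum := by
  induction l with
  | nil => simp
  | cons a l ih => simp [List.flatMap_cons, ih]

/-- **MULTI-LEIBNIZ: `(Π_D∂)(Π_b χ_b) = Σ_{labelings E of D} Π_b (Π_{dirs of E at b}∂)χ_b`** — every `χ′`-contraction hits one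
cube's cutoff. [folklore] [cite: BalabanImbrieJaffe1988, §5.14 p.311–312] -/
theorem dlist_prod : ∀ (L : List (S → ℝ)) (χb : β → (S → ℝ) → ℝ), (∀ b, ContDiff ℝ ∞ (χb b)) →
    dlist L (fun φ => ∏ b, χb b φ) = fun φ => ((labelings L).map fun E => ldl χb E φ).sum
  | [], χb, _ => by
    funext φ
    simp [labelings, ldl_nil]
  | u :: L, χb, hχ => by
    funext φ
    have h1 : (fun ψ => fderiv ℝ (fun ψ => ∏ b, χb b ψ) ψ u)
        = fun ψ => ∑ b₀, (fun ψ => ∏ b, Function.update χb b₀ (fun ψ => fderiv ℝ (χb b₀) ψ u) b ψ) ψ := by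
      funext ψ; exact fderiv_apply_prod hχ u ψ
    rw [dlist_cons, h1, dlist_sum L univ (fun b₀ _ => contDiff_prod fun b _ => contDiff_update hχ b₀ u b)]
    simp only [labelings, sum_map_flatMap, List.map_map, Function.comp_def, ldl_cons]
    rw [← sum_map_toList]
    congr 1
    refine List.map_congr_left fun b₀ _ => ?_
    rw [dlist_prod L _ (contDiff_update hχ b₀ u)]

/-! ## §3  Each labelled summand: smooth, compactly supported, vanishing off the shells of the cubes it hits -/

/-- The labelled summands are continuous. [folklore] [cite: BalabanImbrieJaffe1988, §5.14 p.312] -/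
theorem continuous_ldl {χb : β → (S → ℝ) → ℝ} (hχ : ∀ b, ContDiff ℝ ∞ (χb b)) (E : List ((S → ℝ) × β)) :
    Continuous (ldl χb E) :=
  continuous_finsetProd _ fun b _ => (dlist_contDiff _ (hχ b)).continuous

omit [Fintype S] [Fintype ι] in
/-- Iterated derivatives live on the topological support. [folklore] [cite: BalabanImbrieJaffe1988, §5.14 p.312] -/
theorem tsupport_dlist_subset : ∀ (L : List (S → ℝ)) (g : (S → ℝ) → ℝ), tsupport (dlist L g) ⊆ tsupport g
  | [], _ => subset_rfl
  | u :: L, g => by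
    rw [dlist_cons]
    refine (tsupport_dlist_subset L _).trans ?_
    refine (closure_mono ?_).trans (tsupport_fderiv_subset (𝕜 := ℝ) (f := g))
    intro φ hφ h0
    exact hφ (by simp [h0])

omit [Fintype S] in
/-- A labelled summand lives on the support of every cutoff factor. [folklore] [cite: BalabanImbrieJaffe1988, §5.14 p.312] -/
theorem tsupport_ldl_subset (χb : β → (S → ℝ) → ℝ) (E : List ((S → ℝ) × β)) (b : β) :
    tsupport (ldl χb E) ⊆ tsupport (χb b) := by
  refine (closure_mono ?_).trans (tsupport_dlist_subset (dirsAt b E) (χb b))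
  intro φ hφ
  have h := Finset.support_prod_subset (univ : Finset β) (fun b φ => dlist (dirsAt b E) (χb b) φ) hφ
  exact (Set.mem_iInter₂.1 h) b (mem_univ b)

omit [Fintype S] in
/-- **Compact support of the labelled summands** from `⋂_b tsupport χ_b` compact (for `χ_b(φ) = χ₀(φ|_b)` over cubes
covering all sites this intersection is a product of compact sets). [folklore] [cite: BalabanImbrieJaffe1988, §5.14 p.312] -/
theorem hasCompactSupport_ldl {χb : β → (S → ℝ) → ℝ} (hKc : IsCompact (⋂ b, tsupport (χb b)))
    (E : List ((S → ℝ) × β)) : HasCompactSupport (ldl χb E) :=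
  IsCompact.of_isClosed_subset hKc (isClosed_tsupport _) (Set.subset_iInter fun b => tsupport_ldl_subset χb E b)

/-- `(ldl E)·e^{−V}` is bounded. [folklore] [cite: BalabanImbrieJaffe1988, §5.14 p.312] -/
theorem ldl_vexp_bounded {χb : β → (S → ℝ) → ℝ} (hχ : ∀ b, ContDiff ℝ ∞ (χb b))
    (hKc : IsCompact (⋂ b, tsupport (χb b))) (c : ι → ℝ) (legs : ι → List (S → ℝ)) (E : List ((S → ℝ) × β)) :
    ∃ K, ∀ φ, ‖ldl χb E φ * vexp c legs φ‖ ≤ K :=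
  ((continuous_ldl hχ E).mul (continuous_vexp c legs)).bounded_above_of_compact_support
    ((hasCompactSupport_ldl hKc E).mul_right (f' := vexp c legs))

omit [Fintype S] in
/-- **A LABELLED SUMMAND VANISHES OFF THE SHELL OF EVERY CUBE IT HITS**: if `∂χ_b = 0` off the closed shell `Sh_b` for
every cube, then `ldl χ E = 0` off `⋂_{b ∈ hit E} Sh_b`. [cite: BalabanImbrieJaffe1988, §5.14 p.312] -/
theorem ldl_eq_zero_off_shells {χb : β → (S → ℝ) → ℝ} {Sh : β → Set (S → ℝ)} (hSh : ∀ b, IsClosed (Sh b))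
    (hχS : ∀ b φ, φ ∉ Sh b → fderiv ℝ (χb b) φ = 0) (E : List ((S → ℝ) × β)) (φ : S → ℝ)
    (hφ : φ ∉ ⋂ b ∈ hit E, Sh b) : ldl χb E φ = 0 := by
  simp only [Set.mem_iInter, not_forall] at hφ
  obtain ⟨b, hb, hφb⟩ := hφ
  have hne : dirsAt b E ≠ [] := (mem_filter.1 hb).2
  exact prod_eq_zero (mem_univ b) (dlist_eq_zero_off_shell (hSh b) (hχS b) hne φ hφb)

/-! ## §4  The `χ′`-terms of the expansion, cube by cube -/

variable [DecidableEq S]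

/-- Integral of a finite list of bounded continuous factors against `Π_PΦ · e^{−V} dμ_{C,ℱ}`. [folklore]
[cite: BalabanImbrieJaffe1988, §5.14 p.312] -/
theorem integral_list_sum {A : Matrix S S ℝ} (hA : A.PosDef) (f : S → ℝ) (c : ι → ℝ) (legs : ι → List (S → ℝ))
    (P : List (S → ℝ)) {γ : Type} (g : γ → (S → ℝ) → ℝ) (hgc : ∀ x, Continuous (g x))
    (hgb : ∀ x, ∃ K, ∀ φ, ‖g x φ * vexp c legs φ‖ ≤ K) : ∀ l : List γ,
    ∫ φ : S → ℝ, lmono P φ * ((l.map fun x => g x φ).sum * vexp c legs φ) * (weight A φ * source f φ)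
      = (l.map fun x => ∫ φ : S → ℝ, lmono P φ * (g x φ * vexp c legs φ) * (weight A φ * source f φ)).sum
  | [] => by simp
  | x :: l => by
    have hi : ∀ y : γ, Integrable fun φ : S → ℝ => lmono P φ * (g y φ * vexp c legs φ) * (weight A φ * source f φ) :=
      fun y => by
        obtain ⟨K, hK⟩ := hgb y
        exact integrable_lmono hA f ((hgc y).mul (continuous_vexp c legs)) hK P
    have hil : Integrable fun φ : S → ℝ =>
        lmono P φ * ((l.map fun x => g x φ).sum * vexp c legs φ) * (weight A φ * source f φ) := by
      induction l with
      | nil => simp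
      | cons y l ih =>
        refine ((hi y).add ih).congr (Filter.Eventually.of_forall fun φ => ?_)
        simp only [List.map_cons, List.sum_cons, Pi.add_apply]
        ring
    rw [List.map_cons, List.sum_cons, ← integral_list_sum hA f c legs P g hgc hgb l, ← integral_add (hi x) hil]
    refine integral_congr_ae (Filter.Eventually.of_forall fun φ => ?_)
    simp only [List.map_cons, List.sum_cons]
    ring

/-- **THE `χ′`-TERMS OF THE EXPANSION, CUBE BY CUBE**: for `χ = Π_b χ_b`,
`∫Π_PΦ·(Π_D∂)χ·e^{−V}dμ = Σ_{labelings E of D} ∫Π_PΦ·(Π_b(Π_{E_b}∂)χ_b)·e^{−V}dμ`. [cite: BalabanImbrieJaffe1988, §5.14 p.311–312] -/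
theorem gint_prod_eq_sum {A : Matrix S S ℝ} (hA : A.PosDef) (f : S → ℝ) (c : ι → ℝ) (legs : ι → List (S → ℝ))
    {χb : β → (S → ℝ) → ℝ} (hχ : ∀ b, ContDiff ℝ ∞ (χb b)) (hKc : IsCompact (⋂ b, tsupport (χb b)))
    (P D : List (S → ℝ)) :
    gint A f (fun φ => ∏ b, χb b φ) c legs P D
      = ((labelings D).map fun E =>
          ∫ φ : S → ℝ, lmono P φ * (ldl χb E φ * vexp c legs φ) * (weight A φ * source f φ)).sum := by
  unfold gint
  rw [dlist_prod D χb hχ]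
  exact integral_list_sum hA f c legs P (fun E => ldl χb E) (continuous_ldl hχ) (ldl_vexp_bounded hχ hKc c legs)
    (labelings D)

/-- **THE SMALL FACTOR OF A LABELLED `χ′`-TERM IS THE GAUSSIAN MASS OF THE INTERSECTION OF THE SHELLS OF ALL CUBES IT
HITS** (Cauchy–Schwarz in `L²(dμ_{C,ℱ})`): `|∫Π_PΦ·ldl_E·e^{−V}dμ| ≤ √(∫Π_{P++P}Φdμ) · K_E · √μ(⋂_{b∈hit E} Sh_b)`.
[cite: BalabanImbrieJaffe1988, §5.14 p.312] -/
theorem abs_ldl_integral_le_shells {A : Matrix S S ℝ} (hA : A.PosDef) (f : S → ℝ) (c : ι → ℝ)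
    (legs : ι → List (S → ℝ)) {χb : β → (S → ℝ) → ℝ} (hχ : ∀ b, ContDiff ℝ ∞ (χb b))
    {K : List ((S → ℝ) × β) → ℝ} (hK : ∀ E φ, |ldl χb E φ * vexp c legs φ| ≤ K E) {Sh : β → Set (S → ℝ)}
    (hSh : ∀ b, IsClosed (Sh b)) (hχS : ∀ b φ, φ ∉ Sh b → fderiv ℝ (χb b) φ = 0) (P : List (S → ℝ))
    (E : List ((S → ℝ) × β)) :
    |∫ φ : S → ℝ, lmono P φ * (ldl χb E φ * vexp c legs φ) * (weight A φ * source f φ)|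
      ≤ Real.sqrt (∫ φ : S → ℝ, lmono (P ++ P) φ * (weight A φ * source f φ))
        * (K E * Real.sqrt (∫ φ : S → ℝ, (⋂ b ∈ hit E, Sh b).indicator (fun _ => (1 : ℝ)) φ
            * (weight A φ * source f φ))) := by
  have hPi : Integrable fun φ : S → ℝ => lmono P φ ^ 2 * (weight A φ * source f φ) := by
    have h := integrable_lmono hA f (H := fun _ => (1 : ℝ)) continuous_const (K := 1) (fun _ => by simp) (P ++ P)
    refine h.congr (Filter.Eventually.of_forall fun φ => ?_)
    simp only [lmono_append, mul_one, sq]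
  have hgm : AEStronglyMeasurable (fun φ : S → ℝ => ldl χb E φ * vexp c legs φ) volume :=
    ((continuous_ldl hχ E).mul (continuous_vexp c legs)).aestronglyMeasurable
  have hcl : IsClosed (⋂ b ∈ hit E, Sh b) := isClosed_biInter fun b _ => hSh b
  have h := abs_integral_mul_le_shell hA f (continuous_lmono P) hPi hgm (hK E) hcl.measurableSet
    (fun φ hφ => by simp [ldl_eq_zero_off_shells hSh hχS E φ hφ])
  refine h.trans (le_of_eq ?_)
  congr 2
  exact integral_congr_ae (Filter.Eventually.of_forall fun φ => by simp only [lmono_append, sq])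

omit [DecidableEq S] [Fintype S] [Fintype ι] [Fintype β] [DecidableEq β] in
/-- `|Σ_l| ≤ Σ_l` of bounds. [folklore] -/
private theorem abs_sum_map_le {γ : Type} (l : List γ) (a g : γ → ℝ) (h : ∀ x ∈ l, |a x| ≤ g x) :
    |(l.map a).sum| ≤ (l.map g).sum := by
  induction l with
  | nil => simp
  | cons x l ih =>
    simp only [List.map_cons, List.sum_cons]
    exact (abs_add_le _ _).trans (add_le_add (h x (List.mem_cons_self ..)) (ih fun y hy => h y (List.mem_cons_of_mem x hy)))

/-- **THE `χ′`-TERMS OF A COMPONENT TERM, LOCALIZED**: for `χ = Π_b χ_b` (each `χ_b` smooth, `∂χ_b = 0` off the closed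
shell `Sh_b`, `⋂_b tsupport χ_b` compact), `|∫Π_PΦ·(Π_D∂)χ·e^{−V}dμ| ≤ √(∫Π_{P++P}Φdμ) · Σ_{labelings E of D} K_E ·
√μ(⋂_{b∈hit E} Sh_b)` — the shell factor of a `χ′`-term is that of ALL the cubes its derivatives hit (the sibling
`BIJ88VertexComponentsFieldLaw312.abs_gint_le_shell` had one global shell). [cite: BalabanImbrieJaffe1988, §5.14 p.312] -/
theorem abs_gint_prod_le_shells {A : Matrix S S ℝ} (hA : A.PosDef) (f : S → ℝ) (c : ι → ℝ)
    (legs : ι → List (S → ℝ)) {χb : β → (S → ℝ) → ℝ} (hχ : ∀ b, ContDiff ℝ ∞ (χb b))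
    (hKc : IsCompact (⋂ b, tsupport (χb b))) {K : List ((S → ℝ) × β) → ℝ}
    (hK : ∀ E φ, |ldl χb E φ * vexp c legs φ| ≤ K E) {Sh : β → Set (S → ℝ)} (hSh : ∀ b, IsClosed (Sh b))
    (hχS : ∀ b φ, φ ∉ Sh b → fderiv ℝ (χb b) φ = 0) (P D : List (S → ℝ)) :
    |gint A f (fun φ => ∏ b, χb b φ) c legs P D|
      ≤ Real.sqrt (∫ φ : S → ℝ, lmono (P ++ P) φ * (weight A φ * source f φ))
        * ((labelings D).map fun E : List ((S → ℝ) × β) => K E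
            * Real.sqrt (∫ φ : S → ℝ, (⋂ b ∈ hit E, Sh b).indicator (fun _ => (1 : ℝ)) φ
                * (weight A φ * source f φ))).sum := by
  rw [gint_prod_eq_sum hA f c legs hχ hKc P D, ← List.sum_map_mul_left]
  exact abs_sum_map_le _ _ _ fun E _ => abs_ldl_integral_le_shells hA f c legs hχ hK hSh hχS P E

/-! ## §5  Every labelling of a non-empty list hits a cube; the number of labelings -/

omit [Fintype S] [DecidableEq S] in
/-- A labelling of `u :: L` hits the cube of `u`. [cite: BalabanImbrieJaffe1988, §5.14 p.312] -/
theorem hit_nonempty_of_mem : ∀ {D : List (S → ℝ)}, D ≠ [] → ∀ E ∈ labelings (β := β) D, (hit E).Nonempty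
  | [], h => absurd rfl h
  | u :: L, _ => by
    intro E hE
    simp only [labelings, List.mem_flatMap, Finset.mem_toList, List.mem_map] at hE
    obtain ⟨b, -, E', -, rfl⟩ := hE
    exact ⟨b, mem_hit_cons.2 (Or.inl rfl)⟩

omit [Fintype S] [DecidableEq β] [DecidableEq S] in
/-- There are `|β|^{|D|}` labelings. [cite: BalabanImbrieJaffe1988, §5.14 p.312] -/
theorem length_labelings : ∀ D : List (S → ℝ), (labelings (β := β) D).length = Fintype.card β ^ D.length
  | [] => rfl
  | u :: L => by
    simp only [labelings, List.length_flatMap, List.length_map, length_labelings L, List.map_const',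
      List.sum_replicate, Finset.length_toList, Finset.card_univ, smul_eq_mul, List.length_cons, pow_succ]
    ring

end Literature.MathematicalPhysics.QuantumFieldTheory.BalabanImbrieJaffe1984to88.BIJ88VertexChiCubes312
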